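import Literature.IUT.LogThetaLattice.PacketLogVolumesHaarModelDegree
import Literature.IUT.LogThetaLattice.GlobalKummerNonInterference
import HarnessLib

/-!
# [IUTchIII] Remark 3.10.1 (iii) — the degree ESTIMATE at the GENUINE adelic Haar model (abc-iut cell,
# layer L6; L-F register row LF6-11, F-2097; proof-only, no definitions)

S. Mochizuki, *Inter-universal Teichmüller theory III*, kurims manuscript (May 2020), §3, Remark 3.10.1
(iii), p. 150 [claim: Mochizuki2012, status: disputed]: "one may nevertheless compute — i.e., … 'estimate'
— the global arithmetic degrees of objects of '`𝓕⊛_𝔪𝔬𝔡`' by computing log-volumes [cf. Proposition 3.9,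
(iii)], which are bi-coric". abc-iut-L6-t4 typed this as the schema
`Literature.IUT.LogThetaLattice.Remark3101iii_estimate deg regionOf vol :=
∀ 𝔍 S, regionOf 𝔍 ⊆ S → deg 𝔍 ≤ vol S` (`GlobalKummerNonInterference.lean`, p407875). Its ∀-closure over
free `(deg, vol)` is refuted (`not_forall_Remark3101iii_estimate`, p452607) — the instance forms are the
content. The instance of record (`remark3101iii_estimate_frak`, p410376) lives at the arithmetic-divisor
model, where `vol := divisorLogVolume F` is the divisor-COORDINATE log-volume `c_v · deg_F(v)`.

THIS FILE proves the instance at the GENUINE model of Proposition 3.9 (iii) (abc-iut-L6-d3,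
`PacketLogVolumesHaarModel.lean` p415871 / `PacketLogVolumesHaarModelDegree.lean` p416411): `vol` = the
global log-volume `globalLogVolume (haarPacketLogVolume F)` built from the GENUINE Haar measures of the
completions `F_v` ([AbsTopIII] Prop. 5.7 (i), campaign-S `localVolume` on Mathlib's `v.adicCompletion F`)
and the radial volumes at the archimedean places ([AbsTopIII] Prop. 5.7 (ii), campaign-S `radialVolume`),
regions = the genuine regions `haarIdealRegion F 𝔍 = ∏_v J_v` of the objects `𝔍 = {J_v}` (`IdealFamily F`,
fractional ideals at finite places, dilated unit discs at archimedean ones — the case `K = F_mod = F` of the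
objects of Example 3.6 (ii)), `deg 𝔍 := deg(𝔞_𝔍) = deg_F(𝔞_𝔍)/[F:ℚ]` the tree's NORMALISED arithmetic degree
([IUTchIV] Def. 1.9 (i), campaign-S `ndeg`), and containment of global regions = placewise inclusion of
the underlying admissible subsets (supplied to the schema as an inline anonymous-constructor term for its
`HasSubset` argument — no `instance` is declared; the conclusion head is the FACT decl):

* `placeDatum_vol_mono` — the genuine volume at every place is monotone (`measure_mono` on `F_v`; image
  under the radial projection + `measure_mono` at `∞`);
* `placeDatum_logVol_mono_of_adm` — hence the log-volume is monotone on ADMISSIBLE regions (positive finite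
  volume, print's `𝕄(−)`);
* `haarPacketLogVolume_mono`, `globalLogVolume_haarModel_mono` — so are the packet log-volume `μ^log_{v_ℚ}`
  (positive weights of Remark 3.1.1 (ii)) and the global log-volume `μ^log_{𝕍_ℚ}` (finitely supported sums);
* **`remark3101iii_estimate_haarModel`** — **F-2097 / IUTchIII:Rmk3.10.1(iii) HOLDS at the genuine model**:
  `region(𝔍) ⊆ S ⇒ deg(𝔞_𝔍) ≤ μ^log_{𝕍_ℚ}(S)`, from monotonicity and abc-iut-L6-d3's
  `globalLogVolume_haarIdealRegion_eq_ndeg` (`μ^log_{𝕍_ℚ}(region 𝔍) = deg(𝔞_𝔍)`, Prop. 3.9 (iii));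
  `remark3101iii_estimate_haarModel'` — the same with `deg_F(𝔍)/[F:ℚ]` displayed;
* `remark3101iii_estimate_haarModel_sharp`, `isLeast_globalLogVolume_haarIdealRegion` — the estimate is
  ATTAINED at `region(𝔍)`: the degree IS the least global log-volume of a global region containing it
  ("compute … by computing log-volumes").

HONEST FRAMING: an instance-form theorem at OUR genuine model (classical Haar measure on local fields,
Arakelov degree), not the ∀-closure of the typed schema (refuted) and not an assertion about 𝓕⊛_𝔪𝔬𝔡 as a
Frobenioid; the log-Kummer "upper semi-compatibility" distortions the Remark speaks of are not modelled
here (they concern WHICH regions `S ⊇ region(𝔍)` arise, cf. Remark 3.9.5 / Prop. 3.10); no side taken on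
[IUTchIII] Cor. 3.12; typed ≠ proved; nothing here asserts abc proved or refuted.
[claim: Mochizuki2012, status: disputed] for the IUT sentences quoted; the mathematics is Haar-measure
monotonicity + the tree's `globalLogVolume_haarIdealRegion_eq_ndeg`.
-/

namespace Literature.IUT.LogThetaLattice

open Literature.IUT.LogVolume NumberField IsDedekindDomain MeasureTheory Set
open scoped ENNReal

variable (F : Type) [Field F] [NumberField F]

/-! ### Monotonicity of the genuine volumes -/

/-- The genuine volume at a place of `F` is monotone: at a finite place `v` it is a Haar measure on `F_v`
([AbsTopIII] Prop. 5.7 (i); `measure_mono`), at an archimedean place `w` the radial volume `μ(A) =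
vol(pr_ℝ(A))` ([AbsTopIII] Prop. 5.7 (ii)(a)), monotone since `pr_ℝ(A) ⊆ pr_ℝ(B)` for `A ⊆ B`.
[cite: MochizukiAbsTopIII2015, Prop. 5.7 (i), (ii) p. 137–138] -/
theorem placeDatum_vol_mono (v : Place F) {S T : Set (placeDatum F v).X} (h : S ⊆ T) :
    (placeDatum F v).vol S ≤ (placeDatum F v).vol T := by
  rcases v with w | v
  · show radialVolume S ≤ radialVolume T
    exact measure_mono (image_mono h)
  · exact measure_mono h

/-- On ADMISSIBLE regions (positive finite volume — print's "`𝕄(−)`", [IUTchIII] Prop. 3.9 (i) p. 115) the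
genuine log-volume `μ^log_v = log μ_v` is monotone. [claim: Mochizuki2012, status: disputed] -/
theorem placeDatum_logVol_mono_of_adm (v : Place F) (S T : (placeDatum F v).Adm)
    (h : (S.1 : Set (placeDatum F v).X) ⊆ T.1) :
    (placeDatum F v).logVol S.1 ≤ (placeDatum F v).logVol T.1 := by
  have hS : 0 < ((placeDatum F v).vol S.1).toReal := ENNReal.toReal_pos S.2.1.ne' S.2.2.ne
  exact Real.log_le_log hS (ENNReal.toReal_mono T.2.2.ne (placeDatum_vol_mono F v h))

/-- **[IUTchIII] Prop. 3.9 (i)** (p. 115) at the genuine model: the packet log-volume `μ^log_{v_ℚ}(∏_{v|v_ℚ} T_v)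
= Σ_v c_v·log μ_v(T_v)` is monotone under placewise inclusion of admissible direct-product regions (the
weights `c_v` of Remark 3.1.1 (ii) are positive, `haarWeight_pos`). [claim: Mochizuki2012, status: disputed] -/
theorem haarPacketLogVolume_mono (q : RatPlace) {S T : ∀ v : Packet F q, (placeDatum F v.1).Adm}
    (h : ∀ v, ((S v).1 : Set (placeDatum F v.1).X) ⊆ (T v).1) :
    haarPacketLogVolume F q S ≤ haarPacketLogVolume F q T := by
  unfold haarPacketLogVolume
  exact Finset.sum_le_sum fun v _ =>
    mul_le_mul_of_nonneg_left (placeDatum_logVol_mono_of_adm F v.1 _ _ (h v)) (haarWeight_pos F v.1).le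

/-- **[IUTchIII] Prop. 3.9 (iii)** (p. 117) at the genuine model: the global log-volume `μ^log_{𝕍_ℚ} = Σ_{v_ℚ}
μ^log_{v_ℚ}` ("all but finitely many of which are zero!") is monotone under placewise inclusion of global
regions. [claim: Mochizuki2012, status: disputed] -/
theorem globalLogVolume_haarModel_mono {S T : GlobalRegion (haarPacketLogVolume F)}
    (h : ∀ (q : RatPlace) (v : Packet F q), ((S.1 q v).1 : Set (placeDatum F v.1).X) ⊆ (T.1 q v).1) :
    globalLogVolume (haarPacketLogVolume F) S ≤ globalLogVolume (haarPacketLogVolume F) T := by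
  unfold globalLogVolume
  exact finsum_le_finsum' S.2 T.2 fun q => haarPacketLogVolume_mono F q (h q)

/-! ### Remark 3.10.1 (iii) at the genuine model -/

/-- **F-2097 / IUTchIII:Rmk3.10.1(iii)** (kurims p. 150: "one may nevertheless compute — i.e., … 'estimate' —
the global arithmetic degrees of objects of '`𝓕⊛_𝔪𝔬𝔡`' by computing log-volumes [cf. Proposition 3.9, (iii)],
which are bi-coric") HOLDS AT THE GENUINE ADELIC HAAR MODEL: for the objects `𝔍 = {J_v}` (`IdealFamily F`;
fractional ideals `𝔭_v^{-n_v}𝒪_v` at the finite places, discs `e^{t_w}·𝒪_ℂ` at the archimedean ones), their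
genuine regions `∏_v J_v ⊆ ⊕_{v|v_ℚ} F_v` (`haarIdealRegion`), the NORMALISED arithmetic degree
`deg(𝔞_𝔍) = deg_F(𝔞_𝔍)/[F:ℚ]` ([IUTchIV] Def. 1.9 (i), campaign-S `ndeg`) and the global log-volume of
Proposition 3.9 (iii) built from the genuine Haar / radial measures (`haarPacketLogVolume`, abc-iut-L6-d3),
containment of global regions being placewise inclusion: `region(𝔍) ⊆ S ⇒ deg(𝔞_𝔍) ≤ μ^log_{𝕍_ℚ}(S)`. The
schema's `HasSubset` argument is this placewise inclusion, given as an explicit term (no instance declared).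
[claim: Mochizuki2012, status: disputed] -/
theorem remark3101iii_estimate_haarModel :
    @Remark3101iii_estimate (IdealFamily F) (GlobalRegion (haarPacketLogVolume F))
      ⟨fun S T => ∀ (q : RatPlace) (v : Packet F q),
        ((S.1 q v).1 : Set (placeDatum F v.1).X) ⊆ (T.1 q v).1⟩
      (fun J => ndeg F J.toADivisor) (haarIdealRegion F) (globalLogVolume (haarPacketLogVolume F)) := by
  intro J S hS
  show ndeg F J.toADivisor ≤ _
  rw [← globalLogVolume_haarIdealRegion_eq_ndeg]
  exact globalLogVolume_haarModel_mono F hS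

/-- The same estimate with the degree displayed as `deg_F(𝔍)/[F:ℚ]` (abc-iut-L6-d3's `IdealFamily.deg`,
normalisation `1/[F:ℚ]` of `prop39iii_degree_haarModel`). [claim: Mochizuki2012, status: disputed] -/
theorem remark3101iii_estimate_haarModel' :
    @Remark3101iii_estimate (IdealFamily F) (GlobalRegion (haarPacketLogVolume F))
      ⟨fun S T => ∀ (q : RatPlace) (v : Packet F q),
        ((S.1 q v).1 : Set (placeDatum F v.1).X) ⊆ (T.1 q v).1⟩
      (fun J => J.deg / Module.finrank ℚ F) (haarIdealRegion F) (globalLogVolume (haarPacketLogVolume F)) := by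
  intro J S hS
  show J.deg / Module.finrank ℚ F ≤ _
  rw [← globalLogVolume_haarIdealRegion]
  exact globalLogVolume_haarModel_mono F hS

/-- The estimate unfolded, pointwise: `deg(𝔞_𝔍) ≤ μ^log_{𝕍_ℚ}(S)` for every global region `S` containing `∏_v J_v`
placewise. [claim: Mochizuki2012, status: disputed] -/
theorem ndeg_le_globalLogVolume_of_haarIdealRegion_subset (J : IdealFamily F)
    (S : GlobalRegion (haarPacketLogVolume F))
    (hS : ∀ (q : RatPlace) (v : Packet F q),
      (((haarIdealRegion F J).1 q v).1 : Set (placeDatum F v.1).X) ⊆ (S.1 q v).1) :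
    ndeg F J.toADivisor ≤ globalLogVolume (haarPacketLogVolume F) S :=
  remark3101iii_estimate_haarModel F J S hS

/-- **F-2097 at the genuine model, SHARP**: the estimate is attained — `region(𝔍)` itself is a global region
containing `region(𝔍)` whose global log-volume EQUALS `deg(𝔞_𝔍)` (Prop. 3.9 (iii) at the genuine model,
`globalLogVolume_haarIdealRegion_eq_ndeg`). [claim: Mochizuki2012, status: disputed] -/
theorem remark3101iii_estimate_haarModel_sharp (J : IdealFamily F) :
    ∃ S : GlobalRegion (haarPacketLogVolume F),
      (∀ (q : RatPlace) (v : Packet F q),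
        (((haarIdealRegion F J).1 q v).1 : Set (placeDatum F v.1).X) ⊆ (S.1 q v).1) ∧
      globalLogVolume (haarPacketLogVolume F) S = ndeg F J.toADivisor :=
  ⟨haarIdealRegion F J, fun _ _ => Subset.rfl, globalLogVolume_haarIdealRegion_eq_ndeg F J⟩

/-- **"compute … the global arithmetic degrees … by computing log-volumes"** (p. 150) at the genuine model:
`deg(𝔞_𝔍)` is the LEAST global log-volume of a global region containing `∏_v J_v` placewise.
[claim: Mochizuki2012, status: disputed] -/
theorem isLeast_globalLogVolume_haarIdealRegion (J : IdealFamily F) :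
    IsLeast {μ : ℝ | ∃ S : GlobalRegion (haarPacketLogVolume F),
        (∀ (q : RatPlace) (v : Packet F q),
          (((haarIdealRegion F J).1 q v).1 : Set (placeDatum F v.1).X) ⊆ (S.1 q v).1) ∧
        globalLogVolume (haarPacketLogVolume F) S = μ} (ndeg F J.toADivisor) := by
  refine ⟨remark3101iii_estimate_haarModel_sharp F J, ?_⟩
  rintro μ ⟨S, hS, rfl⟩
  exact remark3101iii_estimate_haarModel F J S hS

/-- … equivalently `deg(𝔞_𝔍)` is the infimum of those global log-volumes. [claim: Mochizuki2012, status: disputed] -/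
theorem ndeg_eq_sInf_globalLogVolume_haarModel (J : IdealFamily F) :
    ndeg F J.toADivisor = sInf {μ : ℝ | ∃ S : GlobalRegion (haarPacketLogVolume F),
        (∀ (q : RatPlace) (v : Packet F q),
          (((haarIdealRegion F J).1 q v).1 : Set (placeDatum F v.1).X) ⊆ (S.1 q v).1) ∧
        globalLogVolume (haarPacketLogVolume F) S = μ} :=
  ((isLeast_globalLogVolume_haarIdealRegion F J).csInf_eq).symm

/-- In particular a global region containing the unit family `𝒪 = {𝒪_v}` placewise ("the local holomorphic
integral structures", Prop. 3.9 (i)) has NONNEGATIVE genuine global log-volume (`deg(𝒪) = 0`).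
[claim: Mochizuki2012, status: disputed] -/
theorem globalLogVolume_nonneg_of_unit_subset (S : GlobalRegion (haarPacketLogVolume F))
    (hS : ∀ (q : RatPlace) (v : Packet F q),
      (((haarIdealRegion F IdealFamily.unit).1 q v).1 : Set (placeDatum F v.1).X) ⊆ (S.1 q v).1) :
    0 ≤ globalLogVolume (haarPacketLogVolume F) S := by
  have h := remark3101iii_estimate_haarModel' F IdealFamily.unit S hS
  simpa [IdealFamily.deg_unit] using h

end Literature.IUT.LogThetaLattice
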